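import Literature.MathematicalPhysics.QuantumFieldTheory.Balaban1983to89.B10Eq54QuadForm
import Literature.MathematicalPhysics.QuantumFieldTheory.Balaban1983to89.B12Eq15QuadraticForm

/-!
# `Balaban1983to89.B12Eq15DictionaryInstance` — T. Bałaban, *Renormalization group approach to lattice gauge field
theories. I*, Commun. Math. Phys. **109** (1987) 249–301 [Balaban1987RG1]: the data of (1.5) p. 261 ASSEMBLED on the
Sect. D dictionary of [13] = T. Bałaban, *Propagators for lattice gauge theories in a background field*, Commun. Math.
Phys. **99** (1985) 389–434 [Balaban1985BackgroundPropagators] ((3.127)–(3.129), (3.156)), and the p. 267 sentence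
«(1.5) = the definition (3.156) [13] with the δ-function gauge fixing term replaced by the exponential one» as a theorem
on the assembled instance

HONEST FRAMING (cell `lit-balaban`, verbatim): statement-level skeleton of published theorems with citation tags; proofs where landed; nothing here is a claim about the Yang–Mills mass gap.

PDF held: `paper:balaban1987-cmp109-rg-i-small-field` (journal page = PDF page + 248; p. 261 = PDF 13, p. 267 = PDF 19,
re-read for this file), `paper:balaban1985-cmp99-background-propagators` ((3.156) p. 428; quoted in `B10Eq54QuadForm`).

THE PRINT.  p. 261: *«The quadratic form in the integral is given by
⟨B, Δ^{(j)}(U_k)B⟩ = ⟨H_{1,j}(U_k)B, Δ₁(U_k)H_{1,j}(U_k)B⟩ − 2⟨H_{1,j}(U_k)hC̃^{(2)}(Ū^j_k, B), J⟩ + G^{(2)}(B), (1.5)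
where the operators H_{1,j}, Δ₁ are defined in Sect. D [13], and C̃^{(2)}(Ū^j_k, B) is the second order polynomial in
the expansion of Q̃(Ū^j_k, B).»*  p. 267: *«Terms of the order 0 in g_k are ⟨H₁hC̃^{(2)}(B′), J⟩ − ½G^{(2)}(B′) −
½⟨H₁B′, Δ₁H₁B′⟩. (2.11)  The quadratic form in B′ above is equal to −1/2⟨B′, Δ^{(k)}B′⟩, see the definition (3.156)
[13] with the δ-function gauge fixing term replaced by the exponential one.»*  [13] (3.156) p. 428:
*«⟨B,(QG₁Q*)⁻¹B⟩ − a⟨B,B⟩ − 2⟨H₁D̃^{(2)}(B), J⟩ = ⟨B, Δ_kB⟩.»*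

WHAT THIS FILE ADDS (the one point recorded on SKELETON row `B12.Eq1.5` by its display owner, HOME/INBOX
2026-08-23T07:34:30Z: *«no single assembled `Data` instance "H := h1Op, Δ₁ := delta1, hop := …, C₂ := …" is
declared — the parametric chain bottoms out in the B9 Sect. D rows»*).  The record `B12Eq15QuadraticForm.Data` (p07)
types (1.5) over print's BY-REFERENCE operators; `B10Eq54QuadForm` (r07) is the finite-dimensional dictionary of
[13] Sect. D at a fixed background (`h1Op` = the operator of (3.127)/(3.110) = (3.129), `delta1` = the bond operator
with the [7] (79) quadratic form on the Landau-gauge slice, `G1inv` = (3.128), `deltaK … E` = THE DEFINITION (3.156))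
and its §4 proves the two Sect. D identities that `Data.eq15_eq_B9_3156` takes as hypotheses.  Here:
* **`dataB9`** — THE ASSEMBLED INSTANCE `Data ℝ (q → ℝ) (b → ℝ) X`: `H := toLin' (h1Op K C Δ N D Q_b)`,
  `Δ₁ := toLinearMap₂' ℝ Δ1` (`Δ1` any bond operator with the (79) slice form, hypothesis `h79`; print's instance
  `delta1`, `B10Eq54QuadForm.eq79_gaugeFixed`), and `hop`, `C₂`, `pairJ`, `G₂` = B12's OWN data of p. 267 / §2
  (`h`, the polar form of `C̃^{(2)}(Ū^j_k, ·)`, `⟨·, J⟩`, the polar form of `G^{(2)}`), left free — they are not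
  objects of [13];
* **`jMatrix D`** — the matrix `E` of the `J`-term `B ↦ ⟨H₁hC̃^{(2)}(B), J⟩` of ANY `Data` on `q → ℝ`
  (`LinearMap.toMatrix₂'` of the middle bilinear map of `Data.form`; `jMatrix_quadForm`), i.e. the `E` that (3.156)
  takes («D̃^{(2)} = C̃^{(2)}», p. 267, composed with `h`);
* `dataB9_eq15` — (1.5) on the instance, unfolded to matrices;
* **`dataB9_eq15_eq_3156`** — p07's `Data.eq15_eq_B9_3156` ON THE INSTANCE WITH BOTH OF ITS HYPOTHESES DISCHARGED BY
  NAME (`h3156` := r07's `h1Op_energy`, `hG` := r07's `G1inv_quadForm_h1Op`):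
  `⟨B, Δ^{(j)}B⟩ = ⟨B, (Q_bG₁Q_bᵀ)⁻¹B⟩ − a⟨B, B⟩ − 2⟨H₁hC̃^{(2)}(B), J⟩ + G^{(2)}(B)`;
* **`dataB9_quad_eq_deltaK`** — THE p. 267 SENTENCE: `⟨B, Δ^{(j)}B⟩ = ⟨B, Δ_kB⟩ + G^{(2)}(B)` with
  `Δ_k := deltaK … (jMatrix dataB9)` = (3.156) («with the δ-function gauge fixing term replaced by the exponential
  one» = the extra `G^{(2)}(B)`); `dataB9_quad_eq_deltaK_delta1` at `Δ1 = delta1`;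
* **`dataB9_quad_eq_two_mul_eq54`** / **`dataB9_quad_eq_deltaK_of_Δa`** — the same number read through
  [Balaban1985UV3] (54) p. 269: (1.5) = 2 × [the left side of (54)] + G^{(2)}(B), hence, by r07's `eq54_of79_of_Δa`,
  `= ⟨B, Δ_kB⟩ + G^{(2)}(B)` with the three nonsingularities of the dictionary DISCHARGED from `Δ_a > 0`
  ((3.111) of [13]) exactly as there; `…_of_Δa_delta1`;
* **`dataB9_eq211`** — (2.11)'s order-0 terms `= −½(⟨B′, Δ_kB′⟩ + G^{(2)}(B′))` (p07's `eq211_quadratic_form` by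
  name + `dataB9_quad_eq_deltaK`).
BY NAME from `B12Eq15QuadraticForm` (p07 p243224) and `B10Eq54QuadForm` (r07 p333649 / v1.1 p334429); nothing of
either file is re-proved or restated; 2 definitions (the instance, the `J`-matrix), theorems; no `Prop` fact, no
`sorry`; axioms standard.

HONEST SCOPE.  (i) The instance lives on the dictionary's carriers (`q → ℝ` block-bond fields, `b → ℝ` fine bond
fields, matrices at ONE fixed background); the identification of its letters with the operators of [13]/[7] AS
FUNCTIONS OF `U_k` is the dictionary's reading (HONEST SCOPE (i) of `B10Eq54QuadForm`), not a theorem.  (ii) `hop`,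
`C₂`, `pairJ`, `G₂` stay parameters: they are B12's p. 267 / §2 objects (rows `B12.Def@267`, `B12.Eq2.5`), whose
concrete forms are of record elsewhere (`B12SecondOrder267Concrete`, `B12GaugeFixExpansion25`); this file does not construct them.
(iii) No positivity of `Δ^{(j)}` on `{Q̃B = 0}`, no bound, no analyticity — exactly as in the two source files.
(iv) Over ℝ only (the dictionary is real; p07's record is over any commutative ring).  Located bookkeeping; NOT summit
progress (not continuum, not Clay).  Unit `lit-balaban-r07` gen 50 (B10 fold owner; free target G.5-34(d), TAKING
HOME/STATUS 2026-08-23T07:42:41Z), HOME `run/shared/lean/pub/lit-balaban/`.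
-/

namespace Literature.MathematicalPhysics.QuantumFieldTheory.Balaban1983to89.B12Eq15DictionaryInstance

open Matrix
open scoped Matrix
open Literature.MathematicalPhysics.QuantumFieldTheory.Balaban1983to89.Beta.Composition (kkt)
open Literature.MathematicalPhysics.QuantumFieldTheory.Balaban1983to89.B9Eq3112 (dcon)
open Literature.MathematicalPhysics.QuantumFieldTheory.Balaban1983to89.B9Eq3152 (G1inv)
open Literature.MathematicalPhysics.QuantumFieldTheory.Balaban1983to89.B10Eq54QuadForm (h1Op delta1)
open Literature.MathematicalPhysics.QuantumFieldTheory.Balaban1983to89.B12Eq15QuadraticForm (Data)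

noncomputable section

variable {n m τ b q σ : Type*} {X : Type*} [AddCommGroup X] [Module ℝ X]

/-! ## §1  The `J`-matrix of a `Data` on `q → ℝ` -/

section JMatrix

variable {W : Type*} [AddCommGroup W] [Module ℝ W]

/-- **The matrix `E` of the `J`-term of (1.5)**: the matrix of the bilinear map `(B₁, B₂) ↦ ⟨H h C₂(B₁, B₂), J⟩`
(the middle term of `Data.form`), so that `⟨B, EB⟩ = ⟨H₁hC̃⁽²⁾(B), J⟩` (`jMatrix_quadForm`) — the `E` of
`B10Eq54QuadForm.deltaK` («D̃⁽²⁾ = C̃⁽²⁾», p. 267). [cite: Balaban1987RG1, (1.5) p.261]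
[cite: Balaban1985BackgroundPropagators, (3.156) p.428] -/
def jMatrix [Fintype q] [DecidableEq q] (D : Data ℝ (q → ℝ) W X) : Matrix q q ℝ :=
  LinearMap.toMatrix₂' ℝ (D.C₂.compr₂ (D.pairJ ∘ₗ D.H ∘ₗ D.hop))

/-- `⟨B₁, EB₂⟩ = ⟨H h C₂(B₁, B₂), J⟩`. [cite: Balaban1987RG1, (1.5) p.261] -/
theorem jMatrix_form [Fintype q] [DecidableEq q] (D : Data ℝ (q → ℝ) W X) (B₁ B₂ : q → ℝ) :
    B₁ ⬝ᵥ jMatrix D *ᵥ B₂ = D.pairJ (D.H (D.hop (D.C₂ B₁ B₂))) := by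
  rw [← Matrix.toLinearMap₂'_apply', jMatrix, Matrix.toLinearMap₂'_toMatrix']
  rfl

/-- **`⟨B, EB⟩ = ⟨H₁hC̃⁽²⁾(B), J⟩`** — the `J`-term of (1.5) is the quadratic form of `jMatrix`.
[cite: Balaban1987RG1, (1.5) p.261] -/
theorem jMatrix_quadForm [Fintype q] [DecidableEq q] (D : Data ℝ (q → ℝ) W X) (B : q → ℝ) :
    B ⬝ᵥ jMatrix D *ᵥ B = D.pairJ (D.H (D.hop (D.Ctwo B))) :=
  jMatrix_form D B B

end JMatrix

/-! ## §2  The assembled instance on the [13] Sect. D dictionary -/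

section Instance

variable [Fintype n] [Fintype τ] [Fintype b] [Fintype q] [DecidableEq τ] [DecidableEq b] [DecidableEq q]

/-- **THE ASSEMBLED (1.5) DATA ON THE DICTIONARY OF [13] SECT. D**: `H := H₁ = h1Op K C Δ N D Q_b` (the operator of
(3.127)/(3.110), `= G₁Q_bᵀ(Q_bG₁Q_bᵀ)⁻¹` (3.129) — `B10Eq54QuadForm.h1Op_eq_3129`), `Δ₁ :=` the bilinear form of a
bond operator `Δ1` (print's: `B10Eq54QuadForm.delta1`, the [7] (79) operator), and B12's own `h`, `C̃⁽²⁾` (polar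
form `C₂`), `⟨·, J⟩`, `G⁽²⁾` (polar form `G₂`). [cite: Balaban1987RG1, (1.5) p.261]
[cite: Balaban1985BackgroundPropagators, (3.127)-(3.129) p.421] -/
def dataB9 (K C : Matrix b b ℝ) (Δ : Matrix n n ℝ) (N : Matrix n τ ℝ) (D : Matrix b n ℝ) (Qb : Matrix q b ℝ)
    (Δ1 : Matrix b b ℝ) (hop : X →ₗ[ℝ] (q → ℝ)) (C₂ : (q → ℝ) →ₗ[ℝ] (q → ℝ) →ₗ[ℝ] X) (pairJ : (b → ℝ) →ₗ[ℝ] ℝ)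
    (G₂ : (q → ℝ) →ₗ[ℝ] (q → ℝ) →ₗ[ℝ] ℝ) : Data ℝ (q → ℝ) (b → ℝ) X where
  H := Matrix.toLin' (h1Op K C Δ N D Qb)
  Δ₁ := Matrix.toLinearMap₂' ℝ Δ1
  hop := hop
  C₂ := C₂
  pairJ := pairJ
  G₂ := G₂

variable (K C : Matrix b b ℝ) (Δ : Matrix n n ℝ) (N : Matrix n τ ℝ) (D : Matrix b n ℝ) (Qb : Matrix q b ℝ)
  (Δ1 : Matrix b b ℝ) (hop : X →ₗ[ℝ] (q → ℝ)) (C₂ : (q → ℝ) →ₗ[ℝ] (q → ℝ) →ₗ[ℝ] X) (pairJ : (b → ℝ) →ₗ[ℝ] ℝ)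
  (G₂ : (q → ℝ) →ₗ[ℝ] (q → ℝ) →ₗ[ℝ] ℝ)

/-- `H B = H₁B`. [cite: Balaban1987RG1, (1.5) p.261] -/
@[simp] theorem dataB9_H_apply (B : q → ℝ) :
    (dataB9 K C Δ N D Qb Δ1 hop C₂ pairJ G₂).H B = h1Op K C Δ N D Qb *ᵥ B :=
  Matrix.toLin'_apply _ _

/-- `⟨A, Δ₁A′⟩ = A ⬝ Δ1A′`. [cite: Balaban1987RG1, (1.5) p.261] -/
@[simp] theorem dataB9_Δ₁_apply (A A' : b → ℝ) :
    (dataB9 K C Δ N D Qb Δ1 hop C₂ pairJ G₂).Δ₁ A A' = A ⬝ᵥ Δ1 *ᵥ A' :=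
  Matrix.toLinearMap₂'_apply' _ _ _

/-- [cite: Balaban1987RG1, (1.5) p.261] -/
@[simp] theorem dataB9_hop : (dataB9 K C Δ N D Qb Δ1 hop C₂ pairJ G₂).hop = hop := rfl

/-- [cite: Balaban1987RG1, (1.5) p.261] -/
@[simp] theorem dataB9_C₂ : (dataB9 K C Δ N D Qb Δ1 hop C₂ pairJ G₂).C₂ = C₂ := rfl

/-- [cite: Balaban1987RG1, (1.5) p.261] -/
@[simp] theorem dataB9_pairJ : (dataB9 K C Δ N D Qb Δ1 hop C₂ pairJ G₂).pairJ = pairJ := rfl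

/-- [cite: Balaban1987RG1, (1.5) p.261] -/
@[simp] theorem dataB9_G₂ : (dataB9 K C Δ N D Qb Δ1 hop C₂ pairJ G₂).G₂ = G₂ := rfl

/-- [cite: Balaban1987RG1, (1.5) p.261] -/
@[simp] theorem dataB9_Ctwo (B : q → ℝ) : (dataB9 K C Δ N D Qb Δ1 hop C₂ pairJ G₂).Ctwo B = C₂ B B := rfl

/-- [cite: Balaban1987RG1, (1.5) p.261] -/
@[simp] theorem dataB9_Gtwo (B : q → ℝ) : (dataB9 K C Δ N D Qb Δ1 hop C₂ pairJ G₂).Gtwo B = G₂ B B := rfl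

/-- **(1.5) ON THE ASSEMBLED INSTANCE, unfolded**:
`⟨B, Δ^{(j)}B⟩ = ⟨H₁B, Δ1·H₁B⟩ − 2⟨H₁hC̃⁽²⁾(B), J⟩ + G⁽²⁾(B)` (p07's `Data.eq15`). [cite: Balaban1987RG1, (1.5) p.261] -/
theorem dataB9_eq15 (B : q → ℝ) :
    (dataB9 K C Δ N D Qb Δ1 hop C₂ pairJ G₂).quad B =
      (h1Op K C Δ N D Qb *ᵥ B) ⬝ᵥ Δ1 *ᵥ (h1Op K C Δ N D Qb *ᵥ B)
        - 2 * pairJ (h1Op K C Δ N D Qb *ᵥ hop (C₂ B B)) + G₂ B B := by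
  rw [Data.eq15]
  simp

/-- The `J`-matrix of the instance: `⟨B, EB⟩ = ⟨H₁hC̃⁽²⁾(B), J⟩` with `H₁ = h1Op …`. [cite: Balaban1987RG1, (1.5) p.261] -/
theorem dataB9_jMatrix_quadForm (B : q → ℝ) :
    B ⬝ᵥ jMatrix (dataB9 K C Δ N D Qb Δ1 hop C₂ pairJ G₂) *ᵥ B = pairJ (h1Op K C Δ N D Qb *ᵥ hop (C₂ B B)) := by
  rw [jMatrix_quadForm]
  simp

/-- **(1.5) OF [Balaban1987RG1] = TWICE THE LEFT SIDE OF (54) OF [Balaban1985UV3] + THE EXPONENTIAL GAUGE-FIXING TERM**: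
`⟨B, Δ^{(j)}B⟩ = 2·[½⟨H₁B, Δ1·H₁B⟩ − ⟨B, EB⟩] + G⁽²⁾(B)`, `E = jMatrix dataB9`. [cite: Balaban1987RG1, (1.5) p.261]
[cite: Balaban1985UV3, (54) p.269] -/
theorem dataB9_quad_eq_two_mul_eq54 (B : q → ℝ) :
    (dataB9 K C Δ N D Qb Δ1 hop C₂ pairJ G₂).quad B =
      2 * ((1 / 2 : ℝ) * ((h1Op K C Δ N D Qb *ᵥ B) ⬝ᵥ Δ1 *ᵥ (h1Op K C Δ N D Qb *ᵥ B))
            - B ⬝ᵥ jMatrix (dataB9 K C Δ N D Qb Δ1 hop C₂ pairJ G₂) *ᵥ B) + G₂ B B := by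
  rw [dataB9_eq15, dataB9_jMatrix_quadForm]
  ring

end Instance

/-! ## §3  The p. 267 sentence: (1.5) = (3.156) of [13] + `G⁽²⁾` — via p07's `eq15_eq_B9_3156`, hypotheses by name -/

section Eq3156

variable [Fintype n] [Fintype m] [Fintype τ] [Fintype b] [Fintype q] [DecidableEq n] [DecidableEq m]
  [DecidableEq τ] [DecidableEq b] [DecidableEq q]

/-- **p07's `Data.eq15_eq_B9_3156` ON THE ASSEMBLED INSTANCE, BOTH HYPOTHESES DISCHARGED BY NAME**
(`h3156` := `B10Eq54QuadForm.h1Op_energy` — «the first step of (3.156)» `⟨H₁B, G₁⁻¹H₁B⟩ = ⟨B, (Q_bG₁Q_bᵀ)⁻¹B⟩`;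
`hG` := `B10Eq54QuadForm.G1inv_quadForm_h1Op` — `⟨H₁B, G₁⁻¹H₁B⟩ = ⟨H₁B, Δ₁H₁B⟩ + a⟨B, B⟩`, (3.128) on the Landau
slice): `⟨B, Δ^{(j)}B⟩ = ⟨B, (Q_bG₁Q_bᵀ)⁻¹B⟩ − a⟨B, B⟩ − 2⟨H₁hC̃⁽²⁾(B), J⟩ + G⁽²⁾(B)`, for any `Δ1` with the [7] (79)
form on `{RD*A′ = 0}`.  Hypotheses = those of `h1Op_energy` (the nonsingularities of [13] Sect. D: bordered matrix
of `(K − 2C, S)`, `G₁⁻¹`, `Q_bG₁Q_bᵀ`; (3.115) `Q_bD = D̄Q`; kernel basis `N` of `Q`).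
[cite: Balaban1987RG1, (1.5) p.261, (2.11) p.267] [cite: Balaban1985BackgroundPropagators, (3.156) p.428, (3.128) p.421] -/
theorem dataB9_eq15_eq_3156 (e : n ≃ τ ⊕ m) (K C : Matrix b b ℝ) (Δ : Matrix n n ℝ) (Q : Matrix m n ℝ) (a : ℝ)
    (hΔ : Δ.IsSymm) (hΔ' : IsUnit (B9H163.Δ' Δ Q a)) (N : Matrix n τ ℝ) (hQN : Q * N = 0)
    (hQM : IsUnit (Q * Qᵀ).det) (hTs : IsUnit (Nᵀ * (Δ * Δ) * N).det) (D : Matrix b n ℝ) (hD : Dᵀ * D = Δ)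
    (Qb : Matrix q b ℝ) (Dbar : Matrix q m ℝ) (h115 : Qb * D = Dbar * Q) (ab : ℝ)
    (hW : IsUnit (kkt (K - (2 : ℝ) • C) (dcon Δ N D Qb)).det) (hG : IsUnit (G1inv K C Δ Q a D Qb ab).det)
    (hP : IsUnit (Qb * (G1inv K C Δ Q a D Qb ab)⁻¹ * Qbᵀ).det) (Δ1 : Matrix b b ℝ)
    (h79 : ∀ A' : b → ℝ, B9H163.R Δ Q a *ᵥ (Dᵀ *ᵥ A') = 0 →
      A' ⬝ᵥ Δ1 *ᵥ A' = A' ⬝ᵥ K *ᵥ A' - 2 * (A' ⬝ᵥ C *ᵥ A'))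
    (hop : X →ₗ[ℝ] (q → ℝ)) (C₂ : (q → ℝ) →ₗ[ℝ] (q → ℝ) →ₗ[ℝ] X) (pairJ : (b → ℝ) →ₗ[ℝ] ℝ)
    (G₂ : (q → ℝ) →ₗ[ℝ] (q → ℝ) →ₗ[ℝ] ℝ) (B : q → ℝ) :
    (dataB9 K C Δ N D Qb Δ1 hop C₂ pairJ G₂).quad B =
      B ⬝ᵥ (Qb * (G1inv K C Δ Q a D Qb ab)⁻¹ * Qbᵀ)⁻¹ *ᵥ B - ab * (B ⬝ᵥ B)
        - 2 * pairJ (h1Op K C Δ N D Qb *ᵥ hop (C₂ B B)) + G₂ B B := by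
  set Dt := dataB9 K C Δ N D Qb Δ1 hop C₂ pairJ G₂ with hDt
  have h3156 : ∀ B' : q → ℝ,
      Matrix.toLinearMap₂' ℝ (G1inv K C Δ Q a D Qb ab) (Dt.H B') (Dt.H B') =
        Matrix.toLinearMap₂' ℝ (1 : Matrix q q ℝ) B'
          (Matrix.toLin' (Qb * (G1inv K C Δ Q a D Qb ab)⁻¹ * Qbᵀ)⁻¹ B') := by
    intro B'
    rw [Matrix.toLinearMap₂'_apply', Matrix.toLinearMap₂'_apply', Matrix.toLin'_apply, one_mulVec, hDt,
      dataB9_H_apply]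
    exact B10Eq54QuadForm.h1Op_energy e K C Δ Q a hΔ hΔ' N hQN hQM hTs D hD Qb Dbar h115 ab hW hG hP B'
  have hGq : ∀ B' : q → ℝ,
      Matrix.toLinearMap₂' ℝ (G1inv K C Δ Q a D Qb ab) (Dt.H B') (Dt.H B') =
        Dt.Δ₁ (Dt.H B') (Dt.H B') + ab * Matrix.toLinearMap₂' ℝ (1 : Matrix q q ℝ) B' B' := by
    intro B'
    rw [Matrix.toLinearMap₂'_apply', Matrix.toLinearMap₂'_apply', one_mulVec, hDt, dataB9_H_apply,
      dataB9_Δ₁_apply]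
    exact B10Eq54QuadForm.G1inv_quadForm_h1Op e K C Δ Q a hΔ hΔ' N hQN hQM hTs D Qb ab hW Δ1 h79 B'
  have h := Dt.eq15_eq_B9_3156 _ _ _ ab h3156 hGq B
  rw [Matrix.toLinearMap₂'_apply', Matrix.toLinearMap₂'_apply', Matrix.toLin'_apply, one_mulVec, one_mulVec]
    at h
  rw [h, hDt]
  simp

/-- **THE p. 267 SENTENCE AS A THEOREM ON THE ASSEMBLED INSTANCE**: *«The quadratic form … is equal to … the
definition (3.156) [13] with the δ-function gauge fixing term replaced by the exponential one»* —
`⟨B, Δ^{(j)}B⟩ = ⟨B, Δ_kB⟩ + G⁽²⁾(B)` with `Δ_k := B10Eq54QuadForm.deltaK … E` = THE DEFINITION (3.156) and `E` the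
`J`-matrix of the instance (`jMatrix`). [cite: Balaban1987RG1, (2.11) p.267, (1.5) p.261]
[cite: Balaban1985BackgroundPropagators, (3.156) p.428] -/
theorem dataB9_quad_eq_deltaK (e : n ≃ τ ⊕ m) (K C : Matrix b b ℝ) (Δ : Matrix n n ℝ) (Q : Matrix m n ℝ) (a : ℝ)
    (hΔ : Δ.IsSymm) (hΔ' : IsUnit (B9H163.Δ' Δ Q a)) (N : Matrix n τ ℝ) (hQN : Q * N = 0)
    (hQM : IsUnit (Q * Qᵀ).det) (hTs : IsUnit (Nᵀ * (Δ * Δ) * N).det) (D : Matrix b n ℝ) (hD : Dᵀ * D = Δ)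
    (Qb : Matrix q b ℝ) (Dbar : Matrix q m ℝ) (h115 : Qb * D = Dbar * Q) (ab : ℝ)
    (hW : IsUnit (kkt (K - (2 : ℝ) • C) (dcon Δ N D Qb)).det) (hG : IsUnit (G1inv K C Δ Q a D Qb ab).det)
    (hP : IsUnit (Qb * (G1inv K C Δ Q a D Qb ab)⁻¹ * Qbᵀ).det) (Δ1 : Matrix b b ℝ)
    (h79 : ∀ A' : b → ℝ, B9H163.R Δ Q a *ᵥ (Dᵀ *ᵥ A') = 0 →
      A' ⬝ᵥ Δ1 *ᵥ A' = A' ⬝ᵥ K *ᵥ A' - 2 * (A' ⬝ᵥ C *ᵥ A'))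
    (hop : X →ₗ[ℝ] (q → ℝ)) (C₂ : (q → ℝ) →ₗ[ℝ] (q → ℝ) →ₗ[ℝ] X) (pairJ : (b → ℝ) →ₗ[ℝ] ℝ)
    (G₂ : (q → ℝ) →ₗ[ℝ] (q → ℝ) →ₗ[ℝ] ℝ) (B : q → ℝ) :
    (dataB9 K C Δ N D Qb Δ1 hop C₂ pairJ G₂).quad B =
      B ⬝ᵥ B10Eq54QuadForm.deltaK K C Δ Q a D Qb ab (jMatrix (dataB9 K C Δ N D Qb Δ1 hop C₂ pairJ G₂)) *ᵥ B + G₂ B B := by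
  rw [dataB9_eq15_eq_3156 e K C Δ Q a hΔ hΔ' N hQN hQM hTs D hD Qb Dbar h115 ab hW hG hP Δ1 h79,
    ← B10Eq54QuadForm.eq_3156, dataB9_jMatrix_quadForm]

/-- The p. 267 sentence at print's `Δ₁` (`B10Eq54QuadForm.delta1`, the [7] (79) operator; `h79` supplied by
`B10Eq54QuadForm.eq79_gaugeFixed`): `⟨B, Δ^{(j)}B⟩ = ⟨B, Δ_kB⟩ + G⁽²⁾(B)`, `Δ_k` := (3.156).
[cite: Balaban1987RG1, (2.11) p.267, (1.5) p.261] [cite: Balaban1985BackgroundPropagators, (3.156) p.428] -/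
theorem dataB9_quad_eq_deltaK_delta1 (e : n ≃ τ ⊕ m) (K C : Matrix b b ℝ) (Δ : Matrix n n ℝ) (Q : Matrix m n ℝ)
    (a : ℝ) (hΔ : Δ.IsSymm) (hΔ' : IsUnit (B9H163.Δ' Δ Q a)) (N : Matrix n τ ℝ) (hQN : Q * N = 0)
    (hQM : IsUnit (Q * Qᵀ).det) (hTs : IsUnit (Nᵀ * (Δ * Δ) * N).det) (D : Matrix b n ℝ) (hD : Dᵀ * D = Δ)
    (Qb : Matrix q b ℝ) (Dbar : Matrix q m ℝ) (h115 : Qb * D = Dbar * Q) (ab : ℝ)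
    (hW : IsUnit (kkt (K - (2 : ℝ) • C) (dcon Δ N D Qb)).det) (hG : IsUnit (G1inv K C Δ Q a D Qb ab).det)
    (hP : IsUnit (Qb * (G1inv K C Δ Q a D Qb ab)⁻¹ * Qbᵀ).det)
    (hop : X →ₗ[ℝ] (q → ℝ)) (C₂ : (q → ℝ) →ₗ[ℝ] (q → ℝ) →ₗ[ℝ] X) (pairJ : (b → ℝ) →ₗ[ℝ] ℝ)
    (G₂ : (q → ℝ) →ₗ[ℝ] (q → ℝ) →ₗ[ℝ] ℝ) (B : q → ℝ) :
    (dataB9 K C Δ N D Qb (delta1 K C Δ Q a D) hop C₂ pairJ G₂).quad B =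
      B ⬝ᵥ B10Eq54QuadForm.deltaK K C Δ Q a D Qb ab (jMatrix (dataB9 K C Δ N D Qb (delta1 K C Δ Q a D) hop C₂ pairJ G₂)) *ᵥ B
        + G₂ B B :=
  dataB9_quad_eq_deltaK e K C Δ Q a hΔ hΔ' N hQN hQM hTs D hD Qb Dbar h115 ab hW hG hP (delta1 K C Δ Q a D)
    (B10Eq54QuadForm.eq79_gaugeFixed K C Δ Q a D) hop C₂ pairJ G₂ B

/-- **(2.11) p. 267, ITS ORDER-ZERO TERMS ON THE ASSEMBLED INSTANCE**: *«Terms of the order 0 in g_k are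
⟨H₁hC̃⁽²⁾(B′), J⟩ − ½G⁽²⁾(B′) − ½⟨H₁B′, Δ₁H₁B′⟩. (2.11) The quadratic form in B′ above is equal to −1/2⟨B′, Δ^{(k)}B′⟩,
see the definition (3.156) [13] …»* — `= −½(⟨B′, Δ_kB′⟩ + G⁽²⁾(B′))`, `Δ_k` := (3.156) (p07's `eq211_quadratic_form`
by name + `dataB9_quad_eq_deltaK`). [cite: Balaban1987RG1, (2.11) p.267]
[cite: Balaban1985BackgroundPropagators, (3.156) p.428] -/
theorem dataB9_eq211 (e : n ≃ τ ⊕ m) (K C : Matrix b b ℝ) (Δ : Matrix n n ℝ) (Q : Matrix m n ℝ) (a : ℝ)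
    (hΔ : Δ.IsSymm) (hΔ' : IsUnit (B9H163.Δ' Δ Q a)) (N : Matrix n τ ℝ) (hQN : Q * N = 0)
    (hQM : IsUnit (Q * Qᵀ).det) (hTs : IsUnit (Nᵀ * (Δ * Δ) * N).det) (D : Matrix b n ℝ) (hD : Dᵀ * D = Δ)
    (Qb : Matrix q b ℝ) (Dbar : Matrix q m ℝ) (h115 : Qb * D = Dbar * Q) (ab : ℝ)
    (hW : IsUnit (kkt (K - (2 : ℝ) • C) (dcon Δ N D Qb)).det) (hG : IsUnit (G1inv K C Δ Q a D Qb ab).det)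
    (hP : IsUnit (Qb * (G1inv K C Δ Q a D Qb ab)⁻¹ * Qbᵀ).det) (Δ1 : Matrix b b ℝ)
    (h79 : ∀ A' : b → ℝ, B9H163.R Δ Q a *ᵥ (Dᵀ *ᵥ A') = 0 →
      A' ⬝ᵥ Δ1 *ᵥ A' = A' ⬝ᵥ K *ᵥ A' - 2 * (A' ⬝ᵥ C *ᵥ A'))
    (hop : X →ₗ[ℝ] (q → ℝ)) (C₂ : (q → ℝ) →ₗ[ℝ] (q → ℝ) →ₗ[ℝ] X) (pairJ : (b → ℝ) →ₗ[ℝ] ℝ)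
    (G₂ : (q → ℝ) →ₗ[ℝ] (q → ℝ) →ₗ[ℝ] ℝ) (B' : q → ℝ) :
    pairJ (h1Op K C Δ N D Qb *ᵥ hop (C₂ B' B')) - (1 / 2 : ℝ) * G₂ B' B'
        - (1 / 2 : ℝ) * ((h1Op K C Δ N D Qb *ᵥ B') ⬝ᵥ Δ1 *ᵥ (h1Op K C Δ N D Qb *ᵥ B')) =
      -(1 / 2 : ℝ) * (B' ⬝ᵥ B10Eq54QuadForm.deltaK K C Δ Q a D Qb ab (jMatrix (dataB9 K C Δ N D Qb Δ1 hop C₂ pairJ G₂)) *ᵥ B'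
        + G₂ B' B') := by
  have h := B12Eq15QuadraticForm.eq211_quadratic_form (dataB9 K C Δ N D Qb Δ1 hop C₂ pairJ G₂) B'
  rw [dataB9_quad_eq_deltaK e K C Δ Q a hΔ hΔ' N hQN hQM hTs D hD Qb Dbar h115 ab hW hG hP Δ1 h79] at h
  simpa using h

end Eq3156

/-! ## §4  The same through (54) of [Balaban1985UV3], nonsingularities from `Δ_a > 0` -/

section OfΔa

variable [Fintype n] [Fintype m] [Fintype τ] [Fintype b] [Fintype q] [Fintype σ] [DecidableEq n] [DecidableEq m]
  [DecidableEq τ] [DecidableEq b] [DecidableEq q] [DecidableEq σ]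

/-- **THE p. 267 SENTENCE FROM `Δ_a > 0` ALONE**, read through (54) p. 269 of [Balaban1985UV3]: (1.5)
`= 2 × [½⟨H₁B, Δ1·H₁B⟩ − ⟨B, EB⟩] + G⁽²⁾(B)` (`dataB9_quad_eq_two_mul_eq54`) `= 2 × ½⟨B, Δ_kB⟩ + G⁽²⁾(B)`
(r07's `B10Eq54QuadForm.eq54_of79_of_Δa`: the bordered matrix, `G₁⁻¹` and `Q_bG₁Q_bᵀ` nonsingular FROM the print's
positivity input `Δ_a = K − 2C + DRD* + a·Q_bᵀQ_b > 0`, (3.111) of [13], and a kernel basis `N_S` of `S`; `K`, `C`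
symmetric). [cite: Balaban1987RG1, (2.11) p.267, (1.5) p.261] [cite: Balaban1985UV3, (54) p.269]
[cite: Balaban1985BackgroundPropagators, (3.156) p.428, (3.111) p.417] -/
theorem dataB9_quad_eq_deltaK_of_Δa (eS : b ≃ σ ⊕ (q ⊕ τ)) (e : n ≃ τ ⊕ m) (K C : Matrix b b ℝ) (hK : Kᵀ = K)
    (hC : Cᵀ = C) (Δ : Matrix n n ℝ) (Q : Matrix m n ℝ) (a : ℝ) (hΔ : Δ.IsSymm)
    (hΔ' : IsUnit (B9H163.Δ' Δ Q a)) (N : Matrix n τ ℝ) (hQN : Q * N = 0) (hQM : IsUnit (Q * Qᵀ).det)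
    (hTs : IsUnit (Nᵀ * (Δ * Δ) * N).det) (D : Matrix b n ℝ) (hD : Dᵀ * D = Δ) (Qb : Matrix q b ℝ)
    (Dbar : Matrix q m ℝ) (h115 : Qb * D = Dbar * Q) (ab : ℝ) (hQbM : IsUnit (Qb * Qbᵀ).det)
    (hΔa : (K - (2 : ℝ) • C + D * B9H163.R Δ Q a * Dᵀ + ab • (Qbᵀ * Qb)).PosDef) (NS : Matrix b σ ℝ)
    (hSN : dcon Δ N D Qb * NS = 0) (hNSA : IsUnit (NSᵀ * NS).det) (Δ1 : Matrix b b ℝ)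
    (h79 : ∀ A' : b → ℝ, B9H163.R Δ Q a *ᵥ (Dᵀ *ᵥ A') = 0 →
      A' ⬝ᵥ Δ1 *ᵥ A' = A' ⬝ᵥ K *ᵥ A' - 2 * (A' ⬝ᵥ C *ᵥ A'))
    (hop : X →ₗ[ℝ] (q → ℝ)) (C₂ : (q → ℝ) →ₗ[ℝ] (q → ℝ) →ₗ[ℝ] X) (pairJ : (b → ℝ) →ₗ[ℝ] ℝ)
    (G₂ : (q → ℝ) →ₗ[ℝ] (q → ℝ) →ₗ[ℝ] ℝ) (B : q → ℝ) :
    (dataB9 K C Δ N D Qb Δ1 hop C₂ pairJ G₂).quad B =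
      B ⬝ᵥ B10Eq54QuadForm.deltaK K C Δ Q a D Qb ab (jMatrix (dataB9 K C Δ N D Qb Δ1 hop C₂ pairJ G₂)) *ᵥ B + G₂ B B := by
  rw [dataB9_quad_eq_two_mul_eq54,
    B10Eq54QuadForm.eq54_of79_of_Δa eS e K C hK hC Δ Q a hΔ hΔ' N hQN hQM hTs D hD Qb Dbar h115 ab hQbM hΔa NS
      hSN hNSA Δ1 h79]
  ring

/-- `dataB9_quad_eq_deltaK_of_Δa` at print's `Δ₁` (`B10Eq54QuadForm.delta1`).
[cite: Balaban1987RG1, (2.11) p.267, (1.5) p.261] [cite: Balaban1985UV3, (54) p.269]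
[cite: Balaban1985BackgroundPropagators, (3.156) p.428, (3.111) p.417] -/
theorem dataB9_quad_eq_deltaK_of_Δa_delta1 (eS : b ≃ σ ⊕ (q ⊕ τ)) (e : n ≃ τ ⊕ m) (K C : Matrix b b ℝ)
    (hK : Kᵀ = K) (hC : Cᵀ = C) (Δ : Matrix n n ℝ) (Q : Matrix m n ℝ) (a : ℝ) (hΔ : Δ.IsSymm)
    (hΔ' : IsUnit (B9H163.Δ' Δ Q a)) (N : Matrix n τ ℝ) (hQN : Q * N = 0) (hQM : IsUnit (Q * Qᵀ).det)
    (hTs : IsUnit (Nᵀ * (Δ * Δ) * N).det) (D : Matrix b n ℝ) (hD : Dᵀ * D = Δ) (Qb : Matrix q b ℝ)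
    (Dbar : Matrix q m ℝ) (h115 : Qb * D = Dbar * Q) (ab : ℝ) (hQbM : IsUnit (Qb * Qbᵀ).det)
    (hΔa : (K - (2 : ℝ) • C + D * B9H163.R Δ Q a * Dᵀ + ab • (Qbᵀ * Qb)).PosDef) (NS : Matrix b σ ℝ)
    (hSN : dcon Δ N D Qb * NS = 0) (hNSA : IsUnit (NSᵀ * NS).det)
    (hop : X →ₗ[ℝ] (q → ℝ)) (C₂ : (q → ℝ) →ₗ[ℝ] (q → ℝ) →ₗ[ℝ] X) (pairJ : (b → ℝ) →ₗ[ℝ] ℝ)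
    (G₂ : (q → ℝ) →ₗ[ℝ] (q → ℝ) →ₗ[ℝ] ℝ) (B : q → ℝ) :
    (dataB9 K C Δ N D Qb (delta1 K C Δ Q a D) hop C₂ pairJ G₂).quad B =
      B ⬝ᵥ B10Eq54QuadForm.deltaK K C Δ Q a D Qb ab (jMatrix (dataB9 K C Δ N D Qb (delta1 K C Δ Q a D) hop C₂ pairJ G₂)) *ᵥ B
        + G₂ B B :=
  dataB9_quad_eq_deltaK_of_Δa eS e K C hK hC Δ Q a hΔ hΔ' N hQN hQM hTs D hD Qb Dbar h115 ab hQbM hΔa NS hSN hNSA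
    (delta1 K C Δ Q a D) (B10Eq54QuadForm.eq79_gaugeFixed K C Δ Q a D) hop C₂ pairJ G₂ B

end OfΔa

end

end Literature.MathematicalPhysics.QuantumFieldTheory.Balaban1983to89.B12Eq15DictionaryInstance
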